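import Mathlib
import Summits.Ventures.LatticeQCDFlow.TrivializingMaps.TrivializingHomeomorph
import Summits.Ventures.LatticeQCDFlow.TrivializingMaps.SuBasisExistence
import HarnessLib

/-!
# The strong-coupling trivializing map, basis-free

HONEST FRAMING: exact (Metropolis-corrected) sampling algorithms for lattice gauge theory; figures
of merit are autocorrelation/cost numbers at stated couplings and volumes; no continuum-physics claim.
Finite periodic lattices `(ℤ/L)^d`; the window `β₀(d,n)` does not depend on `L`.

`StrongCouplingTrivializingMap.lean` / `WilsonMeasureTrivializingMap.lean` carry an orthonormal basis
`B : SuBasis n` of `𝔰𝔲(n)` as a parameter (it enters the construction through THEOREM A's rate `θ₁(d,n,B)`),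
although the CONCLUSION — a trivializing map for `β·S_W` — does not mention it.  `SuBasisExistence.lean`
constructs `stdSuBasis n` for every `n`, so the parameter can be discharged: the statements below quantify over
`d`, `n ≠ 0`, `L` and `β` only.  (M. Lüscher, CMP 293 (2010) 899 [Luscher2010Trivializing], §1, §2.3, §4.2.)
Authored by the pub-lqcd lean-2 seat (cell lqcd-flow, FANOUT row 31 GEN-4). Tags: [ours].
-/

noncomputable section

namespace Summit.Ventures.LatticeQCDFlow.TrivializingMaps

open MeasureTheory
open scoped Matrix Matrix.Norms.Frobenius
open Literature.MathematicalPhysics.QuantumFieldTheory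
open Literature.MathematicalPhysics.QuantumFieldTheory.Luscher2010
open Summit.Ventures.LatticeQCDFlow.Exactness (IsGaugeEquivariant)

namespace StrongCoupling

variable {d n : ℕ}

/-- **Trivializing maps for the SU(n) Wilson action at strong coupling, every volume — basis-free (ours;
PROVED).**  For every `d` and `n ≠ 0` there is `β₀ > 0` such that for EVERY lattice size `L ≥ 1` and every
`|β| < β₀` there is a continuous, gauge-equivariant `𝓕 : SU(n)^E → SU(n)^E` with
`𝓕_* D[V] = 𝒵⁻¹ e^{-β S_W} D[U]` (`IsTrivializingMap`). [ours; cite: Luscher2010Trivializing, §1, §2.3, §4.2] -/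
theorem exists_isTrivializingMap_wilson (hn : n ≠ 0) :
    ∃ β₀ : ℝ, 0 < β₀ ∧ ∀ (L : ℕ) [NeZero L] (β : ℝ), |β| < β₀ →
      ∃ F : GaugeConfig d L (Matrix.specialUnitaryGroup (Fin n) ℂ) →
          GaugeConfig d L (Matrix.specialUnitaryGroup (Fin n) ℂ),
        Continuous F ∧ IsGaugeEquivariant F ∧
        IsTrivializingMap
          (fun U : GaugeConfig d L (Matrix.specialUnitaryGroup (Fin n) ℂ) =>
            β * ambWilsonAction (WilsonFlow.coeConfig U)) F :=
  exists_isTrivializingMap_smul_ambWilsonAction (d := d) hn (SuBasisExistence.stdSuBasis n)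

/-- **The same for Wave 0's Wilson lattice Yang–Mills measure, basis-free (ours; PROVED)**: for every `d` and
`n ≠ 0` there is `β₀ > 0` such that for every `L` and `|β| < β₀` a continuous, gauge-equivariant, measurable
`𝓕` transports the product Haar measure EXACTLY onto `wilsonMeasure ρ₀ β` (defining representation).
[ours; cite: Luscher2010Trivializing, §2.3 eq. (2.9); Wilson1974] -/
theorem exists_map_pi_haar_eq_wilsonMeasure (hn : n ≠ 0) :
    ∃ β₀ : ℝ, 0 < β₀ ∧ ∀ (L : ℕ) [NeZero L] (β : ℝ), |β| < β₀ →
      ∃ F : GaugeConfig d L (Matrix.specialUnitaryGroup (Fin n) ℂ) →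
          GaugeConfig d L (Matrix.specialUnitaryGroup (Fin n) ℂ),
        Continuous F ∧ IsGaugeEquivariant F ∧ Measurable F ∧
        Measure.map F (Measure.pi fun _ : Edge d L => haarProbability (Matrix.specialUnitaryGroup (Fin n) ℂ)) =
          wilsonMeasure (d := d) (L := L) (defRep n) β :=
  exists_isTrivializingMap_wilsonMeasure (d := d) hn (SuBasisExistence.stdSuBasis n)

/-- **Expectations, basis-free**: for every `d`, `n ≠ 0` there is `β₀ > 0` such that for every `L`, `|β| < β₀`
and every observable `𝒪` (a.e.-strongly measurable), `∫ 𝒪 dμ_{Λ,β} = ∫ 𝒪(𝓕 V) ∏ dHaar(V)` with `𝓕` continuous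
and gauge equivariant. [ours; cite: Luscher2010Trivializing, §2.3 eq. (2.9)] -/
theorem exists_integral_wilsonMeasure_eq (hn : n ≠ 0) :
    ∃ β₀ : ℝ, 0 < β₀ ∧ ∀ (L : ℕ) [NeZero L] (β : ℝ), |β| < β₀ →
      ∃ F : GaugeConfig d L (Matrix.specialUnitaryGroup (Fin n) ℂ) →
          GaugeConfig d L (Matrix.specialUnitaryGroup (Fin n) ℂ),
        Continuous F ∧ IsGaugeEquivariant F ∧
        ∀ O : GaugeConfig d L (Matrix.specialUnitaryGroup (Fin n) ℂ) → ℝ,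
          AEStronglyMeasurable O (wilsonMeasure (d := d) (L := L) (defRep n) β) →
          ∫ U, O U ∂(wilsonMeasure (d := d) (L := L) (defRep n) β) =
            ∫ V, O (F V) ∂(Measure.pi fun _ : Edge d L => haarProbability (Matrix.specialUnitaryGroup (Fin n) ℂ)) :=
  exists_integral_wilsonMeasure_comp (d := d) hn (SuBasisExistence.stdSuBasis n)

/-- **A gauge-equivariant trivializing HOMEOMORPHISM, basis-free (ours; PROVED)**: for every `d` and `n ≠ 0`
there is `β₀ > 0` such that for every `L` and `|β| < β₀` a gauge-equivariant homeomorphism `Φ` of `SU(n)^E`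
has `Φ_* D[V] = 𝒵⁻¹ e^{-β S_W} D[U] = wilsonMeasure ρ₀ β`. [ours; cite: Luscher2010Trivializing, §3.2, §4.2] -/
theorem exists_trivializingHomeomorph_wilson (hn : n ≠ 0) :
    ∃ β₀ : ℝ, 0 < β₀ ∧ ∀ (L : ℕ) [NeZero L] (β : ℝ), |β| < β₀ →
      ∃ Φ : GaugeConfig d L (Matrix.specialUnitaryGroup (Fin n) ℂ) ≃ₜ
          GaugeConfig d L (Matrix.specialUnitaryGroup (Fin n) ℂ),
        IsGaugeEquivariant Φ ∧
        IsTrivializingMap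
          (fun U : GaugeConfig d L (Matrix.specialUnitaryGroup (Fin n) ℂ) =>
            β * ambWilsonAction (WilsonFlow.coeConfig U)) Φ ∧
        Measure.map Φ (Measure.pi fun _ : Edge d L => haarProbability (Matrix.specialUnitaryGroup (Fin n) ℂ)) =
          wilsonMeasure (d := d) (L := L) (defRep n) β :=
  ⟨beta0 d n (SuBasisExistence.stdSuBasis n), beta0_pos d n _, fun _ _ _ hβ =>
    exists_trivializingHomeomorph_smul_ambWilsonAction hn (SuBasisExistence.stdSuBasis n) hβ⟩

end StrongCoupling

end Summit.Ventures.LatticeQCDFlow.TrivializingMaps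

end
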